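import Summits.CriticalPhenomena.PercolationContinuityZ3.Theorems.Transplant.FKConnectivityAllQSPWagner
import Summits.CriticalPhenomena.PercolationContinuityZ3.Theorems.Transplant.FKConnectivityAllQSPDualHalves
import Summits.CriticalPhenomena.PercolationContinuityZ3.Theorems.Transplant.FKConnectivityAllQSPParSplitDefs
import HarnessLib

/-!
# Connectivity correlation inequalities for `φ_{w,q}` — file 71b: the SUBDIVIDED TWO-TERMINAL DUAL of a series–parallel network, with the
# ORIENTATION of the first split of a special set (planar duality of the cluster count without planarity: an induction on `IsTTSP`)

Support file (`--supports stmt-CriticalPhenomena-4575`), FK sub-lane `prim-bschramm-fk-2` (gen 31) of the post-continuity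
programme; builds on p205010 (kernel theorem, internal audit signed; external expert review pending).  No definitions, no named
facts, no sorries; standard axioms.

WHY.  The `q`-free antipodal covariance inequality `C_∞⁺` on series–parallel hosts `x ∥ 𝓔` (files 61–64 of this sub-lane) is
SELF-DUAL under two-terminal (planar) duality — series ↔ parallel, contracted ↔ deleted, configuration ↦ complement — and the
duality swaps the series/parallel TYPE of every node of the decomposition tree.  The level-4 programme (`T2⁺`, memo
FROM-fk-2-g31-DUALITY) uses this to place the 2+1 split node of the three specials on a PARALLEL node (`FK.IsParSplit`, file 71d),
where all five facts of the root-form calculus are available.  This file supplies the combinatorial core: for every two-terminal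
series–parallel network `E` between `a, b` on a finite vertex type `V` and every admissible pair of terminal LABELS `U ≠ D` it builds
a dual network `E''` on the vertex type `Finset (Sym2 V) ⊕ Sym2 V` ("faces ⊕ subdivision points") between `inl U` and `inl D`, in
which the dual of the edge `e` is the 2-PATH `inl (φ e) – inr e – inl (ψ e)` (upper face, subdivision point, lower face).  Keeping
the lower half `s(inr e, inl (ψ e))` of every dual edge always open (= contracted) makes `E''` a SIMPLE graph although the planar dual
of a series pair is a parallel pair.  The construction is the obvious recursion (dual of an edge = a 2-path; dual of a SERIES
composition = the PARALLEL composition of the duals between the same two faces; dual of a PARALLEL composition `E₁ ∥ E₂` = the SERIES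
composition of the duals through the new middle face `inl (E₁ ∪ E₂)`), and the identities of planar duality are proved along it from
the tree's gluing laws `clusterCount_series/parallel`, `reachable_series/parallel_iff` (no planarity, no Euler formula):
* `IsTTSP.exists_subdividedDual` — for `IsTTSP E a b`, `U ≠ D` not nonempty subsets of `E`: there are face maps `φ ψ : Sym2 V → Finset (Sym2 V)`
  with (i) `E'' := E.image (e ↦ s(inl (φ e), inr e)) ∪ E.image (e ↦ s(inr e, inl (ψ e)))` a two-terminal series–parallel network between
  `inl U` and `inl D`; (ii) every face label is `U`, `D` or a nonempty subset of `E`; (iii) `φ e ≠ ψ e`; (iv) the CLUSTER-COUNT IDENTITY: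
  for every `ω ⊆ E`, with the dual configuration `ω'' := (E \ ω).image (upper halves) ∪ E.image (lower halves)`,
  `k(ω'') = c + k(ω) + |ω| + 1{a ↔ b in ω}` (finite two-terminal form of `k(ω*) = k(ω) + |ω| − |V| + 1`); (v) TERMINAL DUALITY:
  `inl U ↔ inl D in ω''` iff NOT `a ↔ b in ω`; (vi) ORIENTATION: for every finite `S` with `2 ≤ |S ∩ E|`, `IsParSplit E a b S` or
  `IsParSplit E'' (inl U) (inl D) S''` with `S'' := (S ∩ E).image (upper halves)` — the first node separating `S` is parallel in `E`
  or in its dual.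
The host-level transfer of antipodal sums is the sibling file 71c; the half-edge bookkeeping is file 71a (`…SPDualHalves.lean`).
References: two-terminal series–parallel duality and `k(ω*) = k(ω) + |ω| − |V| + 1` are classical (Whitney 1932; Duffin 1965, §4;
Grimmett 2006, §6.1 eq. (6.3) for the random-cluster form); the gluing laws are Grimmett 2006, (3.90)–(3.91) in counting form.
[cite: Grimmett2006, §6.1 eq. (6.3) (p. 133); §3.9 (pp. 63–64)] [folklore: Duffin 1965, Thm. 1 and §4]
-/

noncomputable section

namespace Summit.CriticalPhenomena.PercolationContinuityZ3.Theorems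

namespace FK

open SimpleGraph Literature.Probability.LatticeModels Literature.Probability.Percolation
open scoped Classical

variable {V : Type*}


/-- Transport of `IsParSplit` along an equality of edge sets (used to absorb `DecidableEq`-instance variants of `∪`). [folklore] -/
theorem IsParSplit.of_eq {W : Type*} {E E' S : Finset (Sym2 W)} {s t : W} (h : IsParSplit E s t S) (he : E = E') :
    IsParSplit E' s t S := he ▸ h

/-- `IsParSplit.base` with instance-free witnesses of `S ∩ Eᵢ ≠ ∅`. [folklore] -/
theorem IsParSplit.base' {W : Type*} {E₁ E₂ S : Finset (Sym2 W)} {s t : W} (h₁ : IsTTSP E₁ s t) (h₂ : IsTTSP E₂ s t)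
    (hd : Disjoint E₁ E₂) (hV : ∀ z : W, (∃ e ∈ E₁, z ∈ e) → (∃ e ∈ E₂, z ∈ e) → z = s ∨ z = t)
    (hS₁ : ∃ e ∈ S, e ∈ E₁) (hS₂ : ∃ e ∈ S, e ∈ E₂) : IsParSplit (E₁ ∪ E₂) s t S := by
  obtain ⟨e₁, h₁S, h₁E⟩ := hS₁
  obtain ⟨e₂, h₂S, h₂E⟩ := hS₂
  exact IsParSplit.base h₁ h₂ hd hV ⟨e₁, Finset.mem_inter.2 ⟨h₁S, h₁E⟩⟩ ⟨e₂, Finset.mem_inter.2 ⟨h₂S, h₂E⟩⟩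

/-! ### The subdivided dual -/

/-- **The subdivided two-terminal dual of a series–parallel network.**  For `IsTTSP E a b` and terminal labels `U ≠ D` that are
not nonempty subsets of `E`, there are face maps `φ ψ` (upper / lower face of each edge) such that the half-edges
`s(inl (φ e), inr e)`, `s(inr e, inl (ψ e))` (`e ∈ E`) form a two-terminal series–parallel network between `inl U` and `inl D` on
`Finset (Sym2 V) ⊕ Sym2 V`, all faces are `U`, `D` or nonempty subsets of `E`, `φ e ≠ ψ e`, and for every `ω ⊆ E` the dual
configuration "upper halves of `E \ ω`, all lower halves" has cluster count `c + k(ω) + |ω| + 1{a ↔ b in ω}` and joins `inl U` to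
`inl D` iff `ω` does NOT join `a` to `b` (finite two-terminal form of `k(ω*) = k(ω) + |ω| − |V| + 1`); and for every `S` with
`2 ≤ |S ∩ E|` the first split of `S` is parallel in `E` or in the dual (`IsParSplit`). [cite: Grimmett2006, §6.1 eq. (6.3) (p. 133)] [folklore: Duffin 1965, §4] -/
theorem IsTTSP.exists_subdividedDual [Fintype V] {E : Finset (Sym2 V)} {a b : V} (hE : IsTTSP E a b) :
    ∀ U D : Finset (Sym2 V), U ≠ D → ¬ (U ⊆ E ∧ U.Nonempty) → ¬ (D ⊆ E ∧ D.Nonempty) →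
    ∃ φ ψ : Sym2 V → Finset (Sym2 V),
      IsTTSP (E.image (fun e => s(Sum.inl (φ e), Sum.inr e)) ∪ E.image (fun e => s(Sum.inr e, Sum.inl (ψ e)))) (Sum.inl U) (Sum.inl D)
      ∧ (∀ e ∈ E, (φ e = U ∨ φ e = D ∨ (φ e ⊆ E ∧ (φ e).Nonempty)) ∧ (ψ e = U ∨ ψ e = D ∨ (ψ e ⊆ E ∧ (ψ e).Nonempty)))
      ∧ (∀ e ∈ E, φ e ≠ ψ e)
      ∧ (∃ c : ℤ, ∀ ω : Finset (Sym2 V), ω ⊆ E →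
          ((clusterCount (↑((E \ ω).image (fun e => s(Sum.inl (φ e), Sum.inr e)) ∪ E.image (fun e => s(Sum.inr e, Sum.inl (ψ e))))
              : BondConfig (Finset (Sym2 V) ⊕ Sym2 V)) ∅ : ℤ)
            = c + clusterCount (↑ω : BondConfig V) ∅ + ω.card + (if (openGraph (↑ω : BondConfig V)).Reachable a b then 1 else 0)))
      ∧ (∀ ω : Finset (Sym2 V), ω ⊆ E →
          ((openGraph (↑((E \ ω).image (fun e => s(Sum.inl (φ e), Sum.inr e)) ∪ E.image (fun e => s(Sum.inr e, Sum.inl (ψ e))))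
              : BondConfig (Finset (Sym2 V) ⊕ Sym2 V))).Reachable (Sum.inl U) (Sum.inl D)
            ↔ ¬ (openGraph (↑ω : BondConfig V)).Reachable a b))
      ∧ (∀ S : Finset (Sym2 V), 2 ≤ (S ∩ E).card →
          IsParSplit E a b S ∨ IsParSplit (E.image (fun e => s(Sum.inl (φ e), Sum.inr e)) ∪ E.image (fun e => s(Sum.inr e, Sum.inl (ψ e))))
            (Sum.inl U) (Sum.inl D) ((S ∩ E).image (fun e => s(Sum.inl (φ e), Sum.inr e)))) := by
  induction hE with
  | @edge a b hab =>
    intro U D hUD _ _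
    have hUD' : (Sum.inl U : Finset (Sym2 V) ⊕ Sym2 V) ≠ Sum.inl D := fun h => hUD (Sum.inl_injective h)
    have h1 : (Sum.inl U : Finset (Sym2 V) ⊕ Sym2 V) ≠ Sum.inr s(a, b) := Sum.inl_ne_inr
    have h2 : (Sum.inr s(a, b) : Finset (Sym2 V) ⊕ Sym2 V) ≠ Sum.inl D := Sum.inr_ne_inl
    -- one-edge and no-edge reachability facts on `V` and on the dual vertex type
    have adj_reach : ∀ {α : Type _} {ω : Finset (Sym2 α)} {p q : α}, s(p, q) ∈ ω → p ≠ q →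
        (openGraph (↑ω : BondConfig α)).Reachable p q := fun h hpq => Adj.reachable ((openGraph_adj _ _ _).2 ⟨Finset.mem_coe.2 h, hpq⟩)
    have empty_reach : ∀ {α : Type _} {p q : α}, (openGraph (∅ : BondConfig α)).Reachable p q → p = q := fun h => by
      rwa [openGraph, fromEdgeSet_empty, reachable_bot] at h
    have hab' : (openGraph (↑({s(a, b)} : Finset (Sym2 V)) : BondConfig V)).Reachable a b := adj_reach (Finset.mem_singleton_self _) hab
    have hab₀ : ¬ (openGraph (↑(∅ : Finset (Sym2 V)) : BondConfig V)).Reachable a b := by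
      rw [Finset.coe_empty]; exact fun h => hab (empty_reach h)
    refine ⟨fun _ => U, fun _ => D, ?_, fun e _ => ⟨Or.inl rfl, Or.inr (Or.inl rfl)⟩, fun e _ => hUD, ?_, ?_, fun S hS =>
      absurd (hS.trans (Finset.card_le_card Finset.inter_subset_right)) (by rw [Finset.card_singleton]; omega)⟩
    · rw [Finset.image_singleton, Finset.image_singleton]
      convert IsTTSP.path₂ h1 h2 hUD' using 3
    · -- the cluster-count identity on the two configurations `∅` and `{ab}`; the constant is read off at `ω = ∅`
      refine ⟨(clusterCount (({s((Sum.inl U : Finset (Sym2 V) ⊕ Sym2 V), Sum.inr s(a, b))} : BondConfig _) ∪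
          {s((Sum.inr s(a, b) : Finset (Sym2 V) ⊕ Sym2 V), Sum.inl D)}) ∅ : ℤ) - Fintype.card V, fun ω hω => ?_⟩
      rcases Finset.subset_singleton_iff.1 hω with rfl | rfl
      · rw [if_neg hab₀, Finset.sdiff_empty, Finset.image_singleton, Finset.image_singleton, Finset.card_empty,
          Finset.coe_union, Finset.coe_singleton, Finset.coe_singleton, Finset.coe_empty,
          show clusterCount (∅ : BondConfig V) ∅ = Fintype.card V from clusterCount_empty_card]
        push_cast; ring
      · -- `ω = {ab}`: three one-edge counts
        have kV := clusterCount_union_pair_add (∅ : BondConfig V) a b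
        rw [if_neg (fun h => hab (empty_reach h)), Set.empty_union,
          show clusterCount (∅ : BondConfig V) ∅ = Fintype.card V from clusterCount_empty_card] at kV
        have kW₁ := clusterCount_union_pair_add (∅ : BondConfig (Finset (Sym2 V) ⊕ Sym2 V)) (Sum.inr s(a, b)) (Sum.inl D)
        rw [if_neg (fun h => h2 (empty_reach h)), Set.empty_union,
          show clusterCount (∅ : BondConfig (Finset (Sym2 V) ⊕ Sym2 V)) ∅ = Fintype.card (Finset (Sym2 V) ⊕ Sym2 V) from
            clusterCount_empty_card] at kW₁
        have kW₂ := clusterCount_union_pair_add ({s((Sum.inr s(a, b) : Finset (Sym2 V) ⊕ Sym2 V), Sum.inl D)} : BondConfig _)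
          (Sum.inl U) (Sum.inr s(a, b))
        rw [if_neg (fun h => h1 (eq_of_reachable_singleton h1 hUD' h)), Set.union_comm] at kW₂
        rw [if_pos hab', Finset.sdiff_self, Finset.image_empty, Finset.empty_union, Finset.image_singleton,
          Finset.card_singleton, Finset.coe_singleton, Finset.coe_singleton]
        push_cast
        omega
    · intro ω hω
      rcases Finset.subset_singleton_iff.1 hω with rfl | rfl
      · rw [Finset.sdiff_empty, Finset.image_singleton, Finset.image_singleton]
        refine iff_of_true ?_ hab₀
        exact (adj_reach (Finset.mem_union_left _ (Finset.mem_singleton_self _)) h1).trans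
          (adj_reach (Finset.mem_union_right _ (Finset.mem_singleton_self _)) h2)
      · rw [Finset.sdiff_self, Finset.image_empty, Finset.empty_union, Finset.image_singleton, Finset.coe_singleton]
        exact iff_of_false (fun h => hUD' (eq_of_reachable_singleton h1 hUD' h)) (fun h => h hab')
  | @series E₁ E₂ a m b h₁ h₂ hd hV ha hb ih₁ ih₂ =>
    intro U D hUD hU hD
    have hUD' : (Sum.inl U : Finset (Sym2 V) ⊕ Sym2 V) ≠ Sum.inl D := fun h => hUD (Sum.inl_injective h)
    have hU₁ : ¬ (U ⊆ E₁ ∧ U.Nonempty) := fun h => hU ⟨h.1.trans Finset.subset_union_left, h.2⟩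
    have hU₂ : ¬ (U ⊆ E₂ ∧ U.Nonempty) := fun h => hU ⟨h.1.trans Finset.subset_union_right, h.2⟩
    have hD₁ : ¬ (D ⊆ E₁ ∧ D.Nonempty) := fun h => hD ⟨h.1.trans Finset.subset_union_left, h.2⟩
    have hD₂ : ¬ (D ⊆ E₂ ∧ D.Nonempty) := fun h => hD ⟨h.1.trans Finset.subset_union_right, h.2⟩
    obtain ⟨φ₁, ψ₁, T₁, R₁, N₁, ⟨c₁, K₁⟩, Q₁, O₁⟩ := ih₁ U D hUD hU₁ hD₁
    obtain ⟨φ₂, ψ₂, T₂, R₂, N₂, ⟨c₂, K₂⟩, Q₂, O₂⟩ := ih₂ U D hUD hU₂ hD₂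
    have gam : a ≠ m := by
      obtain ⟨e, he, hme⟩ := h₂.left_mem
      intro ham; exact ha e he (ham ▸ hme)
    have gbm : b ≠ m := by
      obtain ⟨e, he, hme⟩ := h₁.right_mem
      intro hbm; exact hb e he (hbm ▸ hme)
    have gab : a ≠ b := by
      obtain ⟨e, he, hae⟩ := h₁.left_mem
      intro hab; exact hb e he (hab ▸ hae)
    -- the two dual parts meet only in the terminals `inl U`, `inl D`
    have hVW : ∀ z : Finset (Sym2 V) ⊕ Sym2 V, (∃ x ∈ E₁.image (fun e => s(Sum.inl (φ₁ e), Sum.inr e)) ∪ E₁.image (fun e => s(Sum.inr e, Sum.inl (ψ₁ e))), z ∈ x) →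
        (∃ x ∈ E₂.image (fun e => s(Sum.inl (φ₂ e), Sum.inr e)) ∪ E₂.image (fun e => s(Sum.inr e, Sum.inl (ψ₂ e))), z ∈ x) → z = Sum.inl U ∨ z = Sum.inl D :=
      fun z hz₁ hz₂ => (dual_common_vertex hd R₁ R₂ hU₂ hD₂ hU₁ hD₁ hz₁ hz₂).1
    have hE₁ : (E₁ ∪ E₂) ∩ E₁ = E₁ := Finset.inter_eq_right.2 Finset.subset_union_left
    have hE₂ : (E₁ ∪ E₂) ∩ E₂ = E₂ := Finset.inter_eq_right.2 Finset.subset_union_right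
    refine ⟨fun e => if e ∈ E₁ then φ₁ e else φ₂ e, fun e => if e ∈ E₁ then ψ₁ e else ψ₂ e, ?_, ?_, ?_, ?_⟩
    · -- dual of a series composition = parallel composition of the duals
      rw [dual_split φ₁ ψ₁ φ₂ ψ₂ hd _ subset_rfl, hE₁, hE₂]
      convert IsTTSP.parallel T₁ T₂ (disjoint_dualEdges φ₁ ψ₁ φ₂ ψ₂ (by rwa [Finset.union_self, Finset.union_self])) hVW using 3
    · intro e he
      by_cases h : e ∈ E₁
      · simp only [if_pos h]
        refine ⟨?_, ?_⟩
        · rcases (R₁ e h).1 with h' | h' | h'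
          exacts [Or.inl h', Or.inr (Or.inl h'), Or.inr (Or.inr ⟨h'.1.trans Finset.subset_union_left, h'.2⟩)]
        · rcases (R₁ e h).2 with h' | h' | h'
          exacts [Or.inl h', Or.inr (Or.inl h'), Or.inr (Or.inr ⟨h'.1.trans Finset.subset_union_left, h'.2⟩)]
      · have h2 : e ∈ E₂ := (Finset.mem_union.1 he).resolve_left h
        simp only [if_neg h]
        refine ⟨?_, ?_⟩
        · rcases (R₂ e h2).1 with h' | h' | h'
          exacts [Or.inl h', Or.inr (Or.inl h'), Or.inr (Or.inr ⟨h'.1.trans Finset.subset_union_right, h'.2⟩)]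
        · rcases (R₂ e h2).2 with h' | h' | h'
          exacts [Or.inl h', Or.inr (Or.inl h'), Or.inr (Or.inr ⟨h'.1.trans Finset.subset_union_right, h'.2⟩)]
    · intro e he
      by_cases h : e ∈ E₁
      · simp only [if_pos h]; exact N₁ e h
      · simp only [if_neg h]; exact N₂ e ((Finset.mem_union.1 he).resolve_left h)
    · -- cluster count and terminal duality, configuration by configuration
      have main : ∀ ω : Finset (Sym2 V), ω ⊆ E₁ ∪ E₂ →
          (((clusterCount (↑(((E₁ ∪ E₂) \ ω).image (fun e => s(Sum.inl (if e ∈ E₁ then φ₁ e else φ₂ e), Sum.inr e)) ∪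
              (E₁ ∪ E₂).image (fun e => s(Sum.inr e, Sum.inl (if e ∈ E₁ then ψ₁ e else ψ₂ e)))) : BondConfig (Finset (Sym2 V) ⊕ Sym2 V)) ∅ : ℤ)
            = (c₁ + c₂ - Fintype.card (Finset (Sym2 V) ⊕ Sym2 V) + Fintype.card V + 1) + clusterCount (↑ω : BondConfig V) ∅
              + ω.card + (if (openGraph (↑ω : BondConfig V)).Reachable a b then 1 else 0))
          ∧ ((openGraph (↑(((E₁ ∪ E₂) \ ω).image (fun e => s(Sum.inl (if e ∈ E₁ then φ₁ e else φ₂ e), Sum.inr e)) ∪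
              (E₁ ∪ E₂).image (fun e => s(Sum.inr e, Sum.inl (if e ∈ E₁ then ψ₁ e else ψ₂ e)))) : BondConfig (Finset (Sym2 V) ⊕ Sym2 V))).Reachable
                (Sum.inl U) (Sum.inl D) ↔ ¬ (openGraph (↑ω : BondConfig V)).Reachable a b)) := by
        intro ω hω
        obtain ⟨ω₁, ω₂, rfl, hω₁, hω₂⟩ : ∃ ω₁ ω₂ : Finset (Sym2 V), ω = ω₁ ∪ ω₂ ∧ ω₁ ⊆ E₁ ∧ ω₂ ⊆ E₂ :=
          ⟨ω ∩ E₁, ω ∩ E₂, by rw [← Finset.inter_union_distrib_left, Finset.inter_eq_left.2 hω],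
            Finset.inter_subset_right, Finset.inter_subset_right⟩
        have hωd : Disjoint ω₁ ω₂ := Finset.disjoint_of_subset_left hω₁ (Finset.disjoint_of_subset_right hω₂ hd)
        obtain ⟨hA₁, hA₂⟩ := sdiff_union_inter hd hω₁ hω₂
        rw [dual_split φ₁ ψ₁ φ₂ ψ₂ hd _ Finset.sdiff_subset, hA₁, hA₂, Finset.card_union_of_disjoint hωd]
        -- dual side: parallel gluing between `inl U` and `inl D`; primal side: series gluing at `m`
        obtain ⟨kW, rW⟩ := glue_parallel_finset hVW hUD'
          (Finset.union_subset_union (Finset.image_subset_image (Finset.sdiff_subset (s := E₁) (t := ω₁))) le_rfl)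
          (Finset.union_subset_union (Finset.image_subset_image (Finset.sdiff_subset (s := E₂) (t := ω₂))) le_rfl)
        obtain ⟨kV, rV⟩ := glue_series_finset hV ha hb gam gbm gab hω₁ hω₂
        have e₁ := K₁ ω₁ hω₁
        have e₂ := K₂ ω₂ hω₂
        rw [← Finset.coe_union] at kW rW kV rV
        simp only [Q₁ ω₁ hω₁, Q₂ ω₂ hω₂] at kW rW
        refine ⟨?_, ?_⟩
        · simp only [rV]
          convert dual_arith_series kW kV e₁ e₂ using 3
        · rw [rW, rV]; exact not_and_or.symm
      refine ⟨⟨_, fun ω hω => (main ω hω).1⟩, fun ω hω => (main ω hω).2, ?_⟩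
      -- orientation: a series node with `S` on both sides becomes a PARALLEL split of the dual
      intro S hS
      have hdd := disjoint_dualEdges φ₁ ψ₁ φ₂ ψ₂ (A₁ := E₁) (B₁ := E₁) (A₂ := E₂) (B₂ := E₂) (by rwa [Finset.union_self, Finset.union_self])
      by_cases n₁ : (S ∩ E₁).Nonempty <;> by_cases n₂ : (S ∩ E₂).Nonempty
      · right
        rw [dual_split φ₁ ψ₁ φ₂ ψ₂ hd _ subset_rfl, hE₁, hE₂]
        obtain ⟨e₁, he₁⟩ := n₁
        obtain ⟨e₂, he₂⟩ := n₂
        refine (IsParSplit.base' T₁ T₂ hdd hVW ⟨s(Sum.inl (φ₁ e₁), Sum.inr e₁), ?_, ?_⟩ ⟨s(Sum.inl (φ₂ e₂), Sum.inr e₂), ?_, ?_⟩).of_eq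
          (by ext x; simp only [Finset.mem_union])
        · exact Finset.mem_image.2 ⟨e₁, Finset.mem_inter.2 ⟨(Finset.mem_inter.1 he₁).1, Finset.mem_union_left _ (Finset.mem_inter.1 he₁).2⟩,
            by simp only [if_pos (Finset.mem_inter.1 he₁).2]⟩
        · exact Finset.mem_union_left _ (Finset.mem_image_of_mem _ (Finset.mem_inter.1 he₁).2)
        · exact Finset.mem_image.2 ⟨e₂, Finset.mem_inter.2 ⟨(Finset.mem_inter.1 he₂).1, Finset.mem_union_right _ (Finset.mem_inter.1 he₂).2⟩,
            by simp only [if_neg (Finset.disjoint_right.1 hd (Finset.mem_inter.1 he₂).2)]⟩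
        · exact Finset.mem_union_left _ (Finset.mem_image_of_mem _ (Finset.mem_inter.1 he₂).2)
      · -- only `E₁` meets `S`
        have hS₂ : Disjoint S E₂ := Finset.disjoint_iff_inter_eq_empty.2 (Finset.not_nonempty_iff_eq_empty.1 n₂)
        have hSE : S ∩ (E₁ ∪ E₂) = S ∩ E₁ := by
          rw [Finset.inter_union_distrib_left, Finset.not_nonempty_iff_eq_empty.1 n₂, Finset.union_empty]
        rcases O₁ S (by rw [← hSE]; exact hS) with h | h
        · exact Or.inl (IsParSplit.series_left h h₂ hd hV ha hb hS₂)
        · right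
          rw [dual_split φ₁ ψ₁ φ₂ ψ₂ hd _ subset_rfl, hE₁, hE₂, hSE]
          have himg : (S ∩ E₁).image (fun e => s(Sum.inl (if e ∈ E₁ then φ₁ e else φ₂ e), Sum.inr e)) =
              (S ∩ E₁).image (fun e => s(Sum.inl (φ₁ e), Sum.inr e)) :=
            Finset.image_congr fun e he => by simp only [if_pos (Finset.mem_inter.1 (Finset.mem_coe.1 he)).2]
          rw [himg]
          exact (IsParSplit.parallel_left h T₂ hdd hVW (Finset.disjoint_of_subset_left
            ((Finset.image_subset_image Finset.inter_subset_right).trans Finset.subset_union_left) hdd)).of_eq (by ext x; simp only [Finset.mem_union])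
      · -- only `E₂` meets `S`
        have hS₁ : Disjoint S E₁ := Finset.disjoint_iff_inter_eq_empty.2 (Finset.not_nonempty_iff_eq_empty.1 n₁)
        have hSE : S ∩ (E₁ ∪ E₂) = S ∩ E₂ := by
          rw [Finset.inter_union_distrib_left, Finset.not_nonempty_iff_eq_empty.1 n₁, Finset.empty_union]
        rcases O₂ S (by rw [← hSE]; exact hS) with h | h
        · exact Or.inl (IsParSplit.series_right h₁ h hd hV ha hb hS₁)
        · right
          rw [dual_split φ₁ ψ₁ φ₂ ψ₂ hd _ subset_rfl, hE₁, hE₂, hSE]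
          have himg : (S ∩ E₂).image (fun e => s(Sum.inl (if e ∈ E₁ then φ₁ e else φ₂ e), Sum.inr e)) =
              (S ∩ E₂).image (fun e => s(Sum.inl (φ₂ e), Sum.inr e)) :=
            Finset.image_congr fun e he => by simp only [if_neg (Finset.disjoint_right.1 hd (Finset.mem_inter.1 (Finset.mem_coe.1 he)).2)]
          rw [himg]
          exact (IsParSplit.parallel_right T₁ h hdd hVW (Finset.disjoint_of_subset_left
            ((Finset.image_subset_image Finset.inter_subset_right).trans Finset.subset_union_left) hdd.symm)).of_eq (by ext x; simp only [Finset.mem_union])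
      · exfalso
        rw [Finset.inter_union_distrib_left, Finset.not_nonempty_iff_eq_empty.1 n₁, Finset.not_nonempty_iff_eq_empty.1 n₂,
          Finset.union_empty, Finset.card_empty] at hS
        omega
  | @parallel E₁ E₂ a b h₁ h₂ hd hV ih₁ ih₂ =>
    intro U D hUD hU hD
    have hUD' : (Sum.inl U : Finset (Sym2 V) ⊕ Sym2 V) ≠ Sum.inl D := fun h => hUD (Sum.inl_injective h)
    have hE₁ne : E₁.Nonempty := by obtain ⟨e, he, _⟩ := h₁.left_mem; exact ⟨e, he⟩
    have hE₂ne : E₂.Nonempty := by obtain ⟨e, he, _⟩ := h₂.left_mem; exact ⟨e, he⟩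
    have hEne : (E₁ ∪ E₂).Nonempty := hE₁ne.mono Finset.subset_union_left
    -- the middle face `inl (E₁ ∪ E₂)`; admissibility of the labels for the parts
    have hUM : U ≠ E₁ ∪ E₂ := fun h => hU ⟨h.le, h ▸ hEne⟩
    have hMD : E₁ ∪ E₂ ≠ D := fun h => hD ⟨h.ge, h ▸ hEne⟩
    have hU₁ : ¬ (U ⊆ E₁ ∧ U.Nonempty) := fun h => hU ⟨h.1.trans Finset.subset_union_left, h.2⟩
    have hU₂ : ¬ (U ⊆ E₂ ∧ U.Nonempty) := fun h => hU ⟨h.1.trans Finset.subset_union_right, h.2⟩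
    have hD₁ : ¬ (D ⊆ E₁ ∧ D.Nonempty) := fun h => hD ⟨h.1.trans Finset.subset_union_left, h.2⟩
    have hD₂ : ¬ (D ⊆ E₂ ∧ D.Nonempty) := fun h => hD ⟨h.1.trans Finset.subset_union_right, h.2⟩
    have hM₁ : ¬ (E₁ ∪ E₂ ⊆ E₁ ∧ (E₁ ∪ E₂).Nonempty) := by
      rintro ⟨h, -⟩
      obtain ⟨e, he⟩ := hE₂ne
      exact Finset.disjoint_left.1 hd (h (Finset.mem_union_right _ he)) he
    have hM₂ : ¬ (E₁ ∪ E₂ ⊆ E₂ ∧ (E₁ ∪ E₂).Nonempty) := by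
      rintro ⟨h, -⟩
      obtain ⟨e, he⟩ := hE₁ne
      exact Finset.disjoint_left.1 hd he (h (Finset.mem_union_left _ he))
    have hUM' : (Sum.inl U : Finset (Sym2 V) ⊕ Sym2 V) ≠ Sum.inl (E₁ ∪ E₂) := fun h => hUM (Sum.inl_injective h)
    have hDM' : (Sum.inl D : Finset (Sym2 V) ⊕ Sym2 V) ≠ Sum.inl (E₁ ∪ E₂) := fun h => hMD (Sum.inl_injective h).symm
    obtain ⟨φ₁, ψ₁, T₁, R₁, N₁, ⟨c₁, K₁⟩, Q₁, O₁⟩ := ih₁ U (E₁ ∪ E₂) hUM hU₁ hM₁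
    obtain ⟨φ₂, ψ₂, T₂, R₂, N₂, ⟨c₂, K₂⟩, Q₂, O₂⟩ := ih₂ (E₁ ∪ E₂) D hMD hM₂ hD₂
    -- the two dual parts meet only in the middle face; `inl U` is off part 2 and `inl D` off part 1
    have hVW : ∀ z : Finset (Sym2 V) ⊕ Sym2 V, (∃ x ∈ E₁.image (fun e => s(Sum.inl (φ₁ e), Sum.inr e)) ∪ E₁.image (fun e => s(Sum.inr e, Sum.inl (ψ₁ e))), z ∈ x) →
        (∃ x ∈ E₂.image (fun e => s(Sum.inl (φ₂ e), Sum.inr e)) ∪ E₂.image (fun e => s(Sum.inr e, Sum.inl (ψ₂ e))), z ∈ x) → z = Sum.inl (E₁ ∪ E₂) := by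
      intro z hz₁ hz₂
      obtain ⟨h | h, h' | h'⟩ := dual_common_vertex hd R₁ R₂ hU₂ hM₂ hM₁ hD₁ hz₁ hz₂
      · exact absurd (h.symm.trans h') hUM'
      · exact absurd (h.symm.trans h') hUD'
      · exact h
      · exact h
    have haW := inl_not_mem_dualEdges R₂ hUM hUD hU₂
    have hbW := inl_not_mem_dualEdges R₁ hUD.symm hMD.symm hD₁
    have hE₁ : (E₁ ∪ E₂) ∩ E₁ = E₁ := Finset.inter_eq_right.2 Finset.subset_union_left
    have hE₂ : (E₁ ∪ E₂) ∩ E₂ = E₂ := Finset.inter_eq_right.2 Finset.subset_union_right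
    refine ⟨fun e => if e ∈ E₁ then φ₁ e else φ₂ e, fun e => if e ∈ E₁ then ψ₁ e else ψ₂ e, ?_, ?_, ?_, ?_⟩
    · -- dual of a parallel composition = series composition of the duals through the middle face
      rw [dual_split φ₁ ψ₁ φ₂ ψ₂ hd _ subset_rfl, hE₁, hE₂]
      convert IsTTSP.series T₁ T₂ (disjoint_dualEdges φ₁ ψ₁ φ₂ ψ₂ (by rwa [Finset.union_self, Finset.union_self])) hVW
        haW hbW using 3
    · intro e he
      by_cases h : e ∈ E₁
      · simp only [if_pos h]
        refine ⟨?_, ?_⟩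
        · rcases (R₁ e h).1 with h' | h' | h'
          exacts [Or.inl h', Or.inr (Or.inr ⟨h'.le, h'.symm ▸ hEne⟩), Or.inr (Or.inr ⟨h'.1.trans Finset.subset_union_left, h'.2⟩)]
        · rcases (R₁ e h).2 with h' | h' | h'
          exacts [Or.inl h', Or.inr (Or.inr ⟨h'.le, h'.symm ▸ hEne⟩), Or.inr (Or.inr ⟨h'.1.trans Finset.subset_union_left, h'.2⟩)]
      · have h2 : e ∈ E₂ := (Finset.mem_union.1 he).resolve_left h
        simp only [if_neg h]
        refine ⟨?_, ?_⟩
        · rcases (R₂ e h2).1 with h' | h' | h'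
          exacts [Or.inr (Or.inr ⟨h'.le, h'.symm ▸ hEne⟩), Or.inr (Or.inl h'), Or.inr (Or.inr ⟨h'.1.trans Finset.subset_union_right, h'.2⟩)]
        · rcases (R₂ e h2).2 with h' | h' | h'
          exacts [Or.inr (Or.inr ⟨h'.le, h'.symm ▸ hEne⟩), Or.inr (Or.inl h'), Or.inr (Or.inr ⟨h'.1.trans Finset.subset_union_right, h'.2⟩)]
    · intro e he
      by_cases h : e ∈ E₁
      · simp only [if_pos h]; exact N₁ e h
      · simp only [if_neg h]; exact N₂ e ((Finset.mem_union.1 he).resolve_left h)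
    · -- cluster count and terminal duality, configuration by configuration
      have main : ∀ ω : Finset (Sym2 V), ω ⊆ E₁ ∪ E₂ →
          (((clusterCount (↑(((E₁ ∪ E₂) \ ω).image (fun e => s(Sum.inl (if e ∈ E₁ then φ₁ e else φ₂ e), Sum.inr e)) ∪
              (E₁ ∪ E₂).image (fun e => s(Sum.inr e, Sum.inl (if e ∈ E₁ then ψ₁ e else ψ₂ e)))) : BondConfig (Finset (Sym2 V) ⊕ Sym2 V)) ∅ : ℤ)
            = (c₁ + c₂ - Fintype.card (Finset (Sym2 V) ⊕ Sym2 V) + Fintype.card V) + clusterCount (↑ω : BondConfig V) ∅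
              + ω.card + (if (openGraph (↑ω : BondConfig V)).Reachable a b then 1 else 0))
          ∧ ((openGraph (↑(((E₁ ∪ E₂) \ ω).image (fun e => s(Sum.inl (if e ∈ E₁ then φ₁ e else φ₂ e), Sum.inr e)) ∪
              (E₁ ∪ E₂).image (fun e => s(Sum.inr e, Sum.inl (if e ∈ E₁ then ψ₁ e else ψ₂ e)))) : BondConfig (Finset (Sym2 V) ⊕ Sym2 V))).Reachable
                (Sum.inl U) (Sum.inl D) ↔ ¬ (openGraph (↑ω : BondConfig V)).Reachable a b)) := by
        intro ω hω
        obtain ⟨ω₁, ω₂, rfl, hω₁, hω₂⟩ : ∃ ω₁ ω₂ : Finset (Sym2 V), ω = ω₁ ∪ ω₂ ∧ ω₁ ⊆ E₁ ∧ ω₂ ⊆ E₂ :=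
          ⟨ω ∩ E₁, ω ∩ E₂, by rw [← Finset.inter_union_distrib_left, Finset.inter_eq_left.2 hω],
            Finset.inter_subset_right, Finset.inter_subset_right⟩
        have hωd : Disjoint ω₁ ω₂ := Finset.disjoint_of_subset_left hω₁ (Finset.disjoint_of_subset_right hω₂ hd)
        obtain ⟨hA₁, hA₂⟩ := sdiff_union_inter hd hω₁ hω₂
        rw [dual_split φ₁ ψ₁ φ₂ ψ₂ hd _ Finset.sdiff_subset, hA₁, hA₂, Finset.card_union_of_disjoint hωd]
        -- dual side: series gluing through the middle face; primal side: parallel gluing at `a, b`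
        obtain ⟨kW, rW⟩ := glue_series_finset hVW haW hbW hUM' hDM' hUD'
          (Finset.union_subset_union (Finset.image_subset_image (Finset.sdiff_subset (s := E₁) (t := ω₁))) le_rfl)
          (Finset.union_subset_union (Finset.image_subset_image (Finset.sdiff_subset (s := E₂) (t := ω₂))) le_rfl)
        obtain ⟨kV, rV⟩ := glue_parallel_finset hV h₁.ne hω₁ hω₂
        have e₁ := K₁ ω₁ hω₁
        have e₂ := K₂ ω₂ hω₂
        rw [← Finset.coe_union] at kW rW kV rV
        simp only [Q₁ ω₁ hω₁, Q₂ ω₂ hω₂] at rW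
        refine ⟨?_, ?_⟩
        · simp only [rV]
          convert dual_arith_parallel kW kV e₁ e₂ using 3
        · rw [rW, rV]; exact not_or.symm
      refine ⟨⟨_, fun ω hω => (main ω hω).1⟩, fun ω hω => (main ω hω).2, ?_⟩
      -- orientation: a parallel node with `S` on both sides IS a parallel split; otherwise descend
      intro S hS
      have hdd := disjoint_dualEdges φ₁ ψ₁ φ₂ ψ₂ (A₁ := E₁) (B₁ := E₁) (A₂ := E₂) (B₂ := E₂) (by rwa [Finset.union_self, Finset.union_self])
      by_cases n₁ : (S ∩ E₁).Nonempty <;> by_cases n₂ : (S ∩ E₂).Nonempty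
      · exact Or.inl (IsParSplit.base h₁ h₂ hd hV n₁ n₂)
      · -- only `E₁` meets `S`
        have hS₂ : Disjoint S E₂ := Finset.disjoint_iff_inter_eq_empty.2 (Finset.not_nonempty_iff_eq_empty.1 n₂)
        have hSE : S ∩ (E₁ ∪ E₂) = S ∩ E₁ := by
          rw [Finset.inter_union_distrib_left, Finset.not_nonempty_iff_eq_empty.1 n₂, Finset.union_empty]
        rcases O₁ S (by rw [← hSE]; exact hS) with h | h
        · exact Or.inl (IsParSplit.parallel_left h h₂ hd hV hS₂)
        · right
          rw [dual_split φ₁ ψ₁ φ₂ ψ₂ hd _ subset_rfl, hE₁, hE₂, hSE]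
          have himg : (S ∩ E₁).image (fun e => s(Sum.inl (if e ∈ E₁ then φ₁ e else φ₂ e), Sum.inr e)) =
              (S ∩ E₁).image (fun e => s(Sum.inl (φ₁ e), Sum.inr e)) :=
            Finset.image_congr fun e he => by simp only [if_pos (Finset.mem_inter.1 (Finset.mem_coe.1 he)).2]
          rw [himg]
          exact (IsParSplit.series_left h T₂ hdd hVW haW hbW (Finset.disjoint_of_subset_left
            ((Finset.image_subset_image Finset.inter_subset_right).trans Finset.subset_union_left) hdd)).of_eq (by ext x; simp only [Finset.mem_union])
      · -- only `E₂` meets `S`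
        have hS₁ : Disjoint S E₁ := Finset.disjoint_iff_inter_eq_empty.2 (Finset.not_nonempty_iff_eq_empty.1 n₁)
        have hSE : S ∩ (E₁ ∪ E₂) = S ∩ E₂ := by
          rw [Finset.inter_union_distrib_left, Finset.not_nonempty_iff_eq_empty.1 n₁, Finset.empty_union]
        rcases O₂ S (by rw [← hSE]; exact hS) with h | h
        · exact Or.inl (IsParSplit.parallel_right h₁ h hd hV hS₁)
        · right
          rw [dual_split φ₁ ψ₁ φ₂ ψ₂ hd _ subset_rfl, hE₁, hE₂, hSE]
          have himg : (S ∩ E₂).image (fun e => s(Sum.inl (if e ∈ E₁ then φ₁ e else φ₂ e), Sum.inr e)) =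
              (S ∩ E₂).image (fun e => s(Sum.inl (φ₂ e), Sum.inr e)) :=
            Finset.image_congr fun e he => by simp only [if_neg (Finset.disjoint_right.1 hd (Finset.mem_inter.1 (Finset.mem_coe.1 he)).2)]
          rw [himg]
          exact (IsParSplit.series_right T₁ h hdd hVW haW hbW (Finset.disjoint_of_subset_left
            ((Finset.image_subset_image Finset.inter_subset_right).trans Finset.subset_union_left) hdd.symm)).of_eq (by ext x; simp only [Finset.mem_union])
      · exfalso
        rw [Finset.inter_union_distrib_left, Finset.not_nonempty_iff_eq_empty.1 n₁, Finset.not_nonempty_iff_eq_empty.1 n₂,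
          Finset.union_empty, Finset.card_empty] at hS
        omega

end FK

end Summit.CriticalPhenomena.PercolationContinuityZ3.Theorems

end
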